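import Summits.RiemannHypothesis.RiemannHypothesis.Theorems.PfPersistenceF5NoWithinRangeFake

/-!
# F5 exact depth: the windows blind to a re-weighting are exactly `e^{2a} ≤ X₀` (fake seat 5, gen 4)

Mechanism / rigidity campaign `pub-rhpf` (FAKE SEAT 5, family F5 = prime-sum truncations / beyond-cutoff twins);
**no RH claims** — RH-free, weight-free statements about the even-block map of `PfPersistenceAdmissibleClass.lean`.

`HOME/FAKES.md §5.0` defines the family `F5(X)` (tables equal to a reference table below the cutoff `X`) and the
OPERATIONAL DEPTH of a fake: "agrees with the reference on everything a class measures up to depth `A`" = record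
EQUALITY at every window `(a, N)` with `a ≤ A`.  This file makes the depth EXACT:

* `evenBlock_eq_of_eq_below` (KERNEL of §5.0, all re-weightings at once — the one-dial case is the typer's
  `evenBlock_dial_of_not_mem`): two tables that agree at every position `q < X` have the same even block at every
  window with `e^{2a} ≤ X` (the endpoint `q = X = e^{2a}` included, by `evenBlock_congr_off_endpoint`).
* `evenBlock_eq_iff_exp_le` (EXACT DEPTH): if `X₀ ≥ 2` is the first position where two tables (equal at the junk
  positions `0, 1`) differ, then at every window with `⌊e^{2a}⌋ ≤ N + 1`
  `evenBlock w win = evenBlock w' win ↔ e^{2a} ≤ X₀` — invisible up to depth `a = ½ log X₀` INCLUSIVE, seen by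
  every finer-range window (`→` is F5-INJ, `weights_eq_of_evenBlock_eq_of_floor_le`).  `ζ` instance
  `evenBlock_eq_zeta_iff_exp_le`.

Labels: every `theorem` is PROVED here; nothing is DATA.
-/

set_option linter.dupNamespace false

noncomputable section

open Real Finset

namespace Summit.RiemannHypothesis.RiemannHypothesis.Theorems.PfPersistence

/-- **PROVED (KERNEL of FAKES §5.0: beyond-cutoff re-weightings are invisible).** Two weight tables that agree at
every position `q < X` have the same even block at every window with `e^{2a} ≤ X`. [folklore] -/
theorem evenBlock_eq_of_eq_below (win : Window) {X : ℝ} (hX : Real.exp (2 * win.a) ≤ X) {w w' : Weights}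
    (h : ∀ q : ℕ, (q : ℝ) < X → w q = w' q) : evenBlock w win = evenBlock w' win := by
  refine evenBlock_congr_off_endpoint win fun q hq hlog => h q ?_
  rw [primeRange, Finset.mem_range, Nat.lt_succ_iff] at hq
  have hqle : (q : ℝ) ≤ Real.exp (2 * win.a) := (Nat.cast_le.2 hq).trans (Nat.floor_le (Real.exp_pos _).le)
  rcases hqle.lt_or_eq with hlt | heq
  · exact hlt.trans_le hX
  · exact absurd (by rw [heq, Real.log_exp]) hlog

/-- **PROVED (EXACT DEPTH).** Let two tables agree at the junk positions `0, 1` and at every position below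
`X₀ ≥ 2`, and differ AT `X₀`.  Then at every window with `⌊e^{2a}⌋ ≤ N + 1` the even blocks coincide iff
`e^{2a} ≤ X₀`: the re-weighting is invisible exactly up to depth `a = ½ log X₀` (inclusive) and is seen by every
window reaching beyond `X₀`. [folklore] -/
theorem evenBlock_eq_iff_exp_le (win : Window) (hN : ⌊Real.exp (2 * win.a)⌋₊ ≤ win.N + 1) {w w' : Weights}
    (h0 : w 0 = w' 0) (h1 : w 1 = w' 1) {X₀ : ℕ} (h2 : 2 ≤ X₀) (hne : w X₀ ≠ w' X₀)
    (hbelow : ∀ q : ℕ, q < X₀ → w q = w' q) :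
    evenBlock w win = evenBlock w' win ↔ Real.exp (2 * win.a) ≤ X₀ := by
  constructor
  · intro heq
    by_contra hlt
    push Not at hlt
    have hX₀pos : (0 : ℝ) < X₀ := by exact_mod_cast (show 0 < X₀ by omega)
    have hlog : Real.log X₀ < 2 * win.a := by rw [Real.log_lt_iff_lt_exp hX₀pos]; exact hlt
    exact hne (weights_eq_of_evenBlock_eq_of_floor_le win hN h0 h1 heq X₀ h2 hlog)
  · intro hle
    exact evenBlock_eq_of_eq_below win hle fun q hq => hbelow q (by exact_mod_cast hq)

/-- PROVED (`ζ` instance of the exact depth law): a table vanishing at `0, 1`, equal to `Λ(q) q^{-1/2}` below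
`X₀ ≥ 2` and different at `X₀`, has `ζ`'s even block at a window with `⌊e^{2a}⌋ ≤ N + 1` iff `e^{2a} ≤ X₀`.
(E.g. the prime-deletion twin `primedel p`: `X₀ = p`, invisible iff `a ≤ ½ log p`.) [folklore] -/
theorem evenBlock_eq_zeta_iff_exp_le (win : Window) (hN : ⌊Real.exp (2 * win.a)⌋₊ ≤ win.N + 1) {w : Weights}
    (h0 : w 0 = 0) (h1 : w 1 = 0) {X₀ : ℕ} (h2 : 2 ≤ X₀) (hne : w X₀ ≠ zetaWeights X₀)
    (hbelow : ∀ q : ℕ, q < X₀ → w q = zetaWeights q) :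
    evenBlock w win = evenBlock zetaWeights win ↔ Real.exp (2 * win.a) ≤ X₀ :=
  evenBlock_eq_iff_exp_le win hN (h0.trans zetaWeights_zero.symm) (h1.trans F6Shift.zetaWeights_one.symm) h2 hne
    hbelow

/-- PROVED (the deletion twin, explicitly): for a prime power `p ≥ 2` with `Λ(p) ≠ 0`, the table `dial p 0 ζ`
(`ζ` with the atom at `p` deleted) has `ζ`'s even block at a window with `⌊e^{2a}⌋ ≤ N + 1` iff `e^{2a} ≤ p`.
[folklore] -/
theorem evenBlock_primeDeletion_eq_zeta_iff (win : Window) (hN : ⌊Real.exp (2 * win.a)⌋₊ ≤ win.N + 1) {p : ℕ}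
    (h2 : 2 ≤ p) (hp : zetaWeights p ≠ 0) :
    evenBlock (dial p 0 zetaWeights) win = evenBlock zetaWeights win ↔ Real.exp (2 * win.a) ≤ p := by
  refine evenBlock_eq_zeta_iff_exp_le win hN ?_ ?_ h2 ?_ ?_
  · have : (0 : ℕ) ≠ p := by omega
    simp [dial, this, zetaWeights_zero]
  · have : (1 : ℕ) ≠ p := by omega
    simp [dial, this, F6Shift.zetaWeights_one]
  · simpa [dial] using hp.symm
  · intro q hq
    have : q ≠ p := by omega
    simp [dial, this]

end Summit.RiemannHypothesis.RiemannHypothesis.Theorems.PfPersistence
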